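import Summits.ValiantsHypothesis.ValiantsHypothesis.Theorems.SymPencilPerFourInnerRankRows

/-!
# Route `SymPencil` — the cubic `per [v; a; b; c]`: explicit form, multilinear bookkeeping and
# evaluations at coordinate vectors (tool file for the one-row cells `(12,4,0)` / `(12,4,1)` of
# `sdc(per_4)`, `--supports` stmt-ValiantsHypothesis-5674; nothing here bears on `VP ≠ VNP`)

For `v, a, b, c ∈ K⁴` we record the `4 × 4` permanent `per [v; a; b; c]` (rows) explicitly
(`SymPencilPerFourInnerRankRows.permanent_of_rows`, val-width-5674-p2), its additivity / homogeneity /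
symmetry in the rows `a, b, c`, the vanishing for a zero row or a repeated coordinate row, and the
two evaluations used by the stabiliser computation of `SymPencilPerFourRowStabilizer`:

  `per [v; w; e_q; e_r] = v_p w_s + v_s w_p`,   `per [v; e_p; e_q; e_r] = v_s`

for `{p, q, r, s} = {0, 1, 2, 3}` (`permanent_rows_single_single`, `permanent_rows_three_single`,
by exhaustion over the indices), plus two small facts about vectors / linear maps diagonal in the
coordinate basis.  Elementary bookkeeping. [folklore]
-/

noncomputable section

-- single-conjunct layout: Sub = Summit, duplicated namespace component intended
set_option linter.dupNamespace false

namespace Summit.ValiantsHypothesis.ValiantsHypothesis.Theorems.SymPencilPerFourRowForms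

open Matrix
open Summit.ValiantsHypothesis.ValiantsHypothesis.Theorems.SymPencilPerFourInnerRankRows

variable {K : Type*} [Field K]

/-! ### The cubic `per [v; a; b; c]` explicitly, and its multilinear bookkeeping -/

omit [Field K] in
/-- `Fin.cons v x` as an explicit row vector. [folklore] -/
theorem cons_eq_vecCons (v : Fin 4 → K) (x : Fin 3 → Fin 4 → K) :
    (Fin.cons v x : Fin 4 → Fin 4 → K) = ![v, x 0, x 1, x 2] := by
  ext i j
  fin_cases i <;> rfl

/-- Homogeneity of `per [v; a; b; c]` in the row `a`. [folklore] -/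
theorem permanent_rows_smul₁ (v a b c : Fin 4 → K) (t : K) :
    (Matrix.of ![v, t • a, b, c]).permanent = t * (Matrix.of ![v, a, b, c]).permanent := by
  simp only [permanent_of_rows, Pi.smul_apply, smul_eq_mul]; ring

/-- Symmetry of `per [v; a; b; c]` in the rows `a, b`. [folklore] -/
theorem permanent_rows_swap₁₂ (v a b c : Fin 4 → K) :
    (Matrix.of ![v, a, b, c]).permanent = (Matrix.of ![v, b, a, c]).permanent := by
  simp only [permanent_of_rows]; ring

/-- A zero row kills `per [v; 0; b; c]`. [folklore] -/
theorem permanent_rows_zero₁ (v b c : Fin 4 → K) :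
    (Matrix.of ![v, 0, b, c]).permanent = 0 := by
  simp only [permanent_of_rows, Pi.zero_apply]; ring

/-- Cyclic symmetry `per [v; a; b; c] = per [v; c; a; b]`. [folklore] -/
theorem permanent_rows_cycle (v a b c : Fin 4 → K) :
    (Matrix.of ![v, a, b, c]).permanent = (Matrix.of ![v, c, a, b]).permanent := by
  simp only [permanent_of_rows]; ring

/-! ### Evaluations at coordinate vectors -/

/-- `per [v; w; e_q; e_r] = v_p w_s + v_s w_p` for `{p,q,r,s} = {0,1,2,3}`. [folklore] -/
theorem permanent_rows_single_single (v w : Fin 4 → K) (p q r s : Fin 4)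
    (h : p ≠ q ∧ p ≠ r ∧ p ≠ s ∧ q ≠ r ∧ q ≠ s ∧ r ≠ s) :
    (Matrix.of ![v, w, Pi.single q 1, Pi.single r 1]).permanent = v p * w s + v s * w p := by
  fin_cases p <;> fin_cases q <;> fin_cases r <;> fin_cases s <;>
    simp (config := {decide := true}) at h <;>
    · simp [permanent_of_rows]; try ring

/-- `per [v; e_p; e_q; e_r] = v_s` for `{p,q,r,s} = {0,1,2,3}`. [folklore] -/
theorem permanent_rows_three_single (v : Fin 4 → K) (p q r s : Fin 4)
    (h : p ≠ q ∧ p ≠ r ∧ p ≠ s ∧ q ≠ r ∧ q ≠ s ∧ r ≠ s) :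
    (Matrix.of ![v, Pi.single p 1, Pi.single q 1, Pi.single r 1]).permanent = v s := by
  fin_cases p <;> fin_cases q <;> fin_cases r <;> fin_cases s <;>
    simp (config := {decide := true}) at h <;>
    · simp [permanent_of_rows]

/-- Two equal coordinate rows kill `per [v; e_i; e_i; z]`. [folklore] -/
theorem permanent_rows_rep (v z : Fin 4 → K) (i : Fin 4) :
    (Matrix.of ![v, Pi.single i 1, Pi.single i 1, z]).permanent = 0 := by
  fin_cases i <;> simp [permanent_of_rows]

/-- Completing two distinct indices of `Fin 4` to an enumeration. [folklore] -/
theorem exists_compl_pair : ∀ i p : Fin 4, i ≠ p →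
    ∃ q r : Fin 4, i ≠ q ∧ i ≠ r ∧ p ≠ q ∧ p ≠ r ∧ q ≠ r := by
  decide

/-- Two further distinct indices of `Fin 4`. [folklore] -/
theorem exists_pair_ne : ∀ i : Fin 4, ∃ j k : Fin 4, i ≠ j ∧ i ≠ k ∧ j ≠ k := by
  decide

/-- A vector supported at `i` is a multiple of `e_i`. [folklore] -/
theorem eq_smul_single_of_apply_eq_zero (i : Fin 4) (w : Fin 4 → K)
    (h : ∀ p, p ≠ i → w p = 0) : w = w i • (Pi.single i 1 : Fin 4 → K) := by
  ext p
  by_cases hp : p = i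
  · subst hp; simp
  · rw [h p hp]; simp [hp]

/-- A linear map that scales every `e_i` by the same `c` is `c • id`. [folklore] -/
theorem apply_eq_smul_of_single (Y : (Fin 4 → K) →ₗ[K] (Fin 4 → K)) (c : K)
    (h : ∀ i, Y (Pi.single i 1) = c • (Pi.single i 1 : Fin 4 → K)) (y : Fin 4 → K) :
    Y y = c • y := by
  have hb : ∀ i, Y (Pi.basisFun K (Fin 4) i) =
      (c • LinearMap.id : (Fin 4 → K) →ₗ[K] (Fin 4 → K)) (Pi.basisFun K (Fin 4) i) := fun i => by
    rw [Pi.basisFun_apply, LinearMap.smul_apply, LinearMap.id_apply, h i]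
  simpa using LinearMap.congr_fun ((Pi.basisFun K (Fin 4)).ext hb) y

end Summit.ValiantsHypothesis.ValiantsHypothesis.Theorems.SymPencilPerFourRowForms

end
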